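import Literature.Geometry.Lorentzian.QuasiFinalAnalytic
import HarnessLib

/-!
# Uniform `C²` control on fixed horizon collars (Ellithy 2026, Definition 4.4, bullet 1)

A. Ellithy, *The spacetime Penrose inequality under a quasi final state hypothesis*,
arXiv:2605.18730 (2026), Definition 4.4 (p. 39), Remark 3.7 (p. 21), Lemma 4.7 (p. 40).

**Definition 4.4, bullet 1** (p. 39): "The closure of the exterior region of `𝓗_final` admits a
late-time `C²` coordinate system `(t, r, p) ∈ (T̲, ∞) × [r₀, ∞) × S²` with `𝓗_final = {r = r₀}`.
The coordinate system has uniform `C²` control on fixed collars of `𝓗_final` for all sufficiently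
late `t`. On the exterior region `r > r₀`, the metric takes the general ADM form … and the
coefficient tuple belongs to the class `𝒞𝒮♯_{-τ}(ℳ)`".

The module `Literature.Geometry.Lorentzian.QuasiFinalAnalytic` types the ADM-form, tail-class,
gauge-reducibility, forcing-decay and rest-frame clauses of Def. 4.4 (1)+(2) and §4.1 as
`IsQuasiFinalAnalytic I g Φ T̲ r₀`; the tail class controls the chart only on the tails
`r ≥ r₁ > r₀`, with constants "allowed to deteriorate as `r₁ ↓ r₀`" (Remark 3.7, p. 21).  The one
printed clause of bullet 1 about the chart that is NOT carried by the tail class is the sentence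
"The coordinate system has uniform `C²` control on fixed collars of `𝓗_final` for all sufficiently
late `t`".  The print does not display a formula for it; it is USED in the proof of Lemma 4.7
(p. 40): "By the uniform `C²` control of collars as part of [Def. 4.4 (1)], the induced metrics,
second fundamental forms, and mean curvature vectors of `C²`-small graph spheres over `𝒮_t` depend
continuously on the graph functions, uniformly for all sufficiently late `t`", and Remark 3.7
(p. 21) describes the horizon-penetrating gauges it has in mind: "In horizon-penetrating gauges with
uniform control up to `r = r₀`, one can instead arrange the bounds for `λ`, `N`, and `r H_{t,r}` to
be independent of `r₁`".

This module types that sentence as `HasUniformCollarControl I g Φ T̲ r₀` — the READING (disclosed as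
such): for every fixed collar `[r₀, r₁]`, `r₁ > r₀`, there are a late time `T₁ ≥ T̲`, a width
`ε > 0` and constants `C, c > 0` such that the chart metric `ĝ := (Φ ∘ polar)^* g` (the pullback
of `g` read in the Cartesian slice coordinates `(t, y)`, `y = r p`, exactly the object whose ADM
form `HasADMForm` prescribes on `r > r₀`) agrees on the late open exterior collar
`{t > T₁} × {r₀ < |y| < r₁ + ε}` with a field of bilinear forms `G` which is `C²` on the two-sided
open collar `{t > T₁} × {r₀ - ε < |y| < r₁ + ε}`, all of whose coordinate derivatives of order
`≤ 2` (in `t` AND `y`) are bounded by `C` there, and which is uniformly nondegenerate there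
(`‖G(x) v‖ ≥ c ‖v‖`).  The two-sided `C²` field `G` extending `ĝ` from the open exterior renders
"`C²` coordinate system on the CLOSURE of the exterior region … `[r₀, ∞)`" (one-sided `C²` up to
the boundary `r = r₀` = restriction of a `C²` field across it) without reading the chart `Φ` at or
inside `r = r₀`, where the print does not define it; uniform nondegeneracy is the "uniform control
up to `r = r₀`" of Remark 3.7 and is what makes the continuity moduli of Lemma 4.7 uniform in `t`.

Also: `IsQuasiFinalAnalyticCollar I g Φ T̲ r₀ := IsQuasiFinalAnalytic I g Φ T̲ r₀ ∧
HasUniformCollarControl I g Φ T̲ r₀` — Def. 4.4 (1)+(2) + §4.1 with the collar sentence included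
(the GEOMETRIC clauses of bullet 1 — `𝓗_final = {r = r₀}` is the last smooth MOTS piece — and
bullet 3 are statements about the horizon, not about the chart metric, and stay outside).
API: restriction to smaller collars / later times (`HasUniformCollarControl.of_le`), unpacking.

Typing a definition proves nothing: no fact of the paper is stated here.

## References

* [Ellithy2026] A. Ellithy, arXiv:2605.18730 (2026), Def. 4.4 (p. 39), Remark 3.7 (p. 21),
  Lemma 4.7 (p. 40).
-/

noncomputable section

open Set Metric
open scoped Manifold ContDiff

namespace Literature.Geometry.Lorentzian

section Chart

variable {EM : Type*} [NormedAddCommGroup EM] [NormedSpace ℝ EM] {HM : Type*}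
  [TopologicalSpace HM] (I : ModelWithCorners ℝ EM HM) {M : Type*} [TopologicalSpace M]
  [ChartedSpace HM M]

/-- The late **two-sided open collar** `{t > T₁} × {a < |y| < b}` of the Cartesian slice
coordinates `(t, y)` (for the collar `[r₀, r₁]` of Def. 4.4 one takes `a = r₀ - ε`, `b = r₁ + ε`).
[cite: Ellithy2026, Def. 4.4 p. 39] -/
def lateShell (T₁ a b : ℝ) : Set (ℝ × E3) :=
  {q | T₁ < q.1 ∧ a < ‖q.2‖ ∧ ‖q.2‖ < b}

/-- The late shell is an open subset of `ℝ × E3`. [cite: Ellithy2026, Def. 4.4 p. 39] -/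
theorem isOpen_lateShell (T₁ a b : ℝ) : IsOpen (lateShell T₁ a b) := by
  have h1 : IsOpen {q : ℝ × E3 | T₁ < q.1} := isOpen_lt continuous_const continuous_fst
  have h2 : IsOpen {q : ℝ × E3 | a < ‖q.2‖} := isOpen_lt continuous_const continuous_snd.norm
  have h3 : IsOpen {q : ℝ × E3 | ‖q.2‖ < b} := isOpen_lt continuous_snd.norm continuous_const
  simpa only [lateShell, setOf_and] using h1.inter (h2.inter h3)

/-- Shells shrink with their parameters: `T₁ ≤ T₁'`, `a ≤ a'`, `b' ≤ b` give
`lateShell T₁' a' b' ⊆ lateShell T₁ a b`. [cite: Ellithy2026, Def. 4.4 p. 39] -/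
theorem lateShell_mono {T₁ T₁' a a' b b' : ℝ} (hT : T₁ ≤ T₁') (ha : a ≤ a') (hb : b' ≤ b) :
    lateShell T₁' a' b' ⊆ lateShell T₁ a b :=
  fun _ hq ↦ ⟨hT.trans_lt hq.1, ha.trans_lt hq.2.1, hq.2.2.trans_le hb⟩

/-- **The chart metric** `ĝ = (Φ ∘ polar)^* g` at `(t, y)`: the spacetime metric read in the late
chart through the Cartesian slice coordinates `y = r p` — the bilinear form on `ℝ × E3` which
`HasADMForm I g Φ T̲ r₀ 𝒮` equates with the ADM form of `𝒮` on `{t > T̲} × {|y| > r₀}`.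
[cite: Ellithy2026, Def. 4.4 p. 39] -/
def chartMetric (g : Π x : M, TangentSpace I x →L[ℝ] TangentSpace I x →L[ℝ] ℝ)
    (Φ : ℝ × ℝ × sphere (0 : E3) 1 → M) (q : ℝ × E3) : (ℝ × E3) →L[ℝ] (ℝ × E3) →L[ℝ] ℝ :=
  pullbackBilin (I := I) (I' := 𝓘(ℝ, ℝ × E3)) (polarChart Φ) g q

/-- `HasADMForm` says exactly that the chart metric is the ADM form of the tuple on the late open
exterior. [cite: Ellithy2026, Def. 4.4 p. 39] -/
theorem HasADMForm.chartMetric_eq {g : Π x : M, TangentSpace I x →L[ℝ] TangentSpace I x →L[ℝ] ℝ}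
    {Φ : ℝ × ℝ × sphere (0 : E3) 1 → M} {Tlo r₀ : ℝ} {S : ADMTailTuple}
    (h : HasADMForm I g Φ Tlo r₀ S) {t : ℝ} {y : E3} (ht : Tlo < t) (hy : r₀ < ‖y‖) :
    chartMetric I g Φ (t, y) = S.admForm t y :=
  h t y ht hy

/-- **Uniform `C²` control of the chart on ONE collar** `[r₀, r₁]` after time `T₁`, with width `ε`
and constants `C`, `c` (Ellithy 2026, Def. 4.4 (1), p. 39, as read in the module docstring): there
is a field `G` of bilinear forms on `ℝ × E3` which is `C²` on the two-sided open collar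
`{t > T₁} × {r₀ - ε < |y| < r₁ + ε}`, agrees with the chart metric `(Φ ∘ polar)^* g` on its open
exterior part `{t > T₁} × {r₀ < |y| < r₁ + ε}`, has all coordinate derivatives of order `≤ 2`
bounded by `C` on the two-sided collar, and is uniformly nondegenerate there: `‖G(x) v‖ ≥ c ‖v‖`.
[cite: Ellithy2026, Def. 4.4 p. 39] -/
def HasCollarControlWith (g : Π x : M, TangentSpace I x →L[ℝ] TangentSpace I x →L[ℝ] ℝ)
    (Φ : ℝ × ℝ × sphere (0 : E3) 1 → M) (r₀ r₁ T₁ ε C c : ℝ) : Prop :=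
  ∃ G : ℝ × E3 → (ℝ × E3) →L[ℝ] (ℝ × E3) →L[ℝ] ℝ,
    ContDiffOn ℝ 2 G (lateShell T₁ (r₀ - ε) (r₁ + ε)) ∧
    (∀ q ∈ lateShell T₁ r₀ (r₁ + ε), G q = chartMetric I g Φ q) ∧
    (∀ q ∈ lateShell T₁ (r₀ - ε) (r₁ + ε), ∀ k ≤ 2, ‖iteratedFDeriv ℝ k G q‖ ≤ C) ∧
    (∀ q ∈ lateShell T₁ (r₀ - ε) (r₁ + ε), ∀ v : ℝ × E3, c * ‖v‖ ≤ ‖G q v‖)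

/-- **"The coordinate system has uniform `C²` control on fixed collars of `𝓗_final` for all
sufficiently late `t`"** (Ellithy 2026, Def. 4.4, bullet 1, p. 39; used in the proof of Lemma 4.7,
p. 40, and glossed by Remark 3.7, p. 21), as read in the module docstring: for every fixed collar
`[r₀, r₁]`, `r₁ > r₀`, there are a late time `T₁ ≥ T̲`, a width `ε > 0` and constants `C`, `c > 0`
with `HasCollarControlWith I g Φ r₀ r₁ T₁ ε C c`. [cite: Ellithy2026, Def. 4.4 p. 39] -/
def HasUniformCollarControl (g : Π x : M, TangentSpace I x →L[ℝ] TangentSpace I x →L[ℝ] ℝ)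
    (Φ : ℝ × ℝ × sphere (0 : E3) 1 → M) (Tlo r₀ : ℝ) : Prop :=
  ∀ r₁, r₀ < r₁ → ∃ T₁ ε C c : ℝ, Tlo ≤ T₁ ∧ 0 < ε ∧ 0 < c ∧
    HasCollarControlWith I g Φ r₀ r₁ T₁ ε C c

/-- **Definition 4.4 (1)+(2) and §4.1 for the late chart, collar sentence included**: the analytic
clauses `IsQuasiFinalAnalytic I g Φ T̲ r₀` (ADM form, `𝒞𝒮♯_{-τ}` tail class, gauge reducibility,
forcing decay, rest frame) together with uniform `C²` control on fixed collars.  The geometric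
clauses of bullet 1 (`𝓗_final = {r = r₀}` is the last smooth horizon piece) and bullet 3 (area
stabilization) are statements about the horizon and are not typed here.
[cite: Ellithy2026, Def. 4.4 p. 39] -/
def IsQuasiFinalAnalyticCollar (g : Π x : M, TangentSpace I x →L[ℝ] TangentSpace I x →L[ℝ] ℝ)
    (Φ : ℝ × ℝ × sphere (0 : E3) 1 → M) (Tlo r₀ : ℝ) : Prop :=
  IsQuasiFinalAnalytic I g Φ Tlo r₀ ∧ HasUniformCollarControl I g Φ Tlo r₀

variable {I}
variable {g : Π x : M, TangentSpace I x →L[ℝ] TangentSpace I x →L[ℝ] ℝ}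
  {Φ : ℝ × ℝ × sphere (0 : E3) 1 → M}

/-- Control with parameters `(T₁, ε, C, c)` on the collar `[r₀, r₁]` gives control with any later
time `T₁' ≥ T₁`, smaller width `0 < ε' ≤ ε`, larger bound `C' ≥ C` and smaller `c' ≤ c` on any
sub-collar `[r₀, r₁']`, `r₁' ≤ r₁` (restriction of the same field `G`).
[cite: Ellithy2026, Def. 4.4 p. 39] -/
theorem HasCollarControlWith.of_le {r₀ r₁ r₁' T₁ T₁' ε ε' C C' c c' : ℝ}
    (h : HasCollarControlWith I g Φ r₀ r₁ T₁ ε C c) (hr : r₁' ≤ r₁) (hT : T₁ ≤ T₁')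
    (hε : ε' ≤ ε) (hC : C ≤ C') (hc : c' ≤ c) :
    HasCollarControlWith I g Φ r₀ r₁' T₁' ε' C' c' := by
  obtain ⟨G, hG, hGeq, hGb, hGc⟩ := h
  have hsub : lateShell T₁' (r₀ - ε') (r₁' + ε') ⊆ lateShell T₁ (r₀ - ε) (r₁ + ε) :=
    lateShell_mono hT (by linarith) (by linarith)
  have hsub' : lateShell T₁' r₀ (r₁' + ε') ⊆ lateShell T₁ r₀ (r₁ + ε) :=
    lateShell_mono hT le_rfl (by linarith)
  refine ⟨G, hG.mono hsub, fun q hq ↦ hGeq q (hsub' hq), fun q hq k hk ↦ ?_, fun q hq v ↦ ?_⟩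
  · exact (hGb q (hsub hq) k hk).trans hC
  · exact (mul_le_mul_of_nonneg_right hc (norm_nonneg v)).trans (hGc q (hsub hq) v)

/-- Unpacking: uniform collar control yields, for each collar, the controlled `C²` field `G` on a
two-sided open collar agreeing with the chart metric outside `r₀`.
[cite: Ellithy2026, Def. 4.4 p. 39] -/
theorem HasUniformCollarControl.exists_field {Tlo r₀ : ℝ} (h : HasUniformCollarControl I g Φ Tlo r₀)
    {r₁ : ℝ} (hr₁ : r₀ < r₁) :
    ∃ T₁ ε C c : ℝ, Tlo ≤ T₁ ∧ 0 < ε ∧ 0 < c ∧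
      ∃ G : ℝ × E3 → (ℝ × E3) →L[ℝ] (ℝ × E3) →L[ℝ] ℝ,
        ContDiffOn ℝ 2 G (lateShell T₁ (r₀ - ε) (r₁ + ε)) ∧
        (∀ q ∈ lateShell T₁ r₀ (r₁ + ε), G q = chartMetric I g Φ q) ∧
        (∀ q ∈ lateShell T₁ (r₀ - ε) (r₁ + ε), ∀ k ≤ 2, ‖iteratedFDeriv ℝ k G q‖ ≤ C) ∧
        (∀ q ∈ lateShell T₁ (r₀ - ε) (r₁ + ε), ∀ v : ℝ × E3, c * ‖v‖ ≤ ‖G q v‖) :=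
  h r₁ hr₁

/-- Uniform collar control after `T̲` is uniform collar control after any EARLIER reference time
`T̲' ≤ T̲` (the late times `T₁ ≥ T̲ ≥ T̲'` serve both). [cite: Ellithy2026, Def. 4.4 p. 39] -/
theorem HasUniformCollarControl.of_le {Tlo Tlo' r₀ : ℝ} (h : HasUniformCollarControl I g Φ Tlo r₀)
    (hT : Tlo' ≤ Tlo) : HasUniformCollarControl I g Φ Tlo' r₀ := by
  intro r₁ hr₁
  obtain ⟨T₁, ε, C, c, hT₁, hε, hc, hW⟩ := h r₁ hr₁
  exact ⟨T₁, ε, C, c, hT.trans hT₁, hε, hc, hW⟩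

/-- On the controlled exterior collar the chart metric itself is uniformly nondegenerate and
bounded: for `t > T₁` and `r₀ < |y| < r₁ + ε`, `c ‖v‖ ≤ ‖ĝ(t, y) v‖` and `‖ĝ(t, y)‖ ≤ C`.
[cite: Ellithy2026, Def. 4.4 p. 39] -/
theorem HasCollarControlWith.chartMetric_bounds {r₀ r₁ T₁ ε C c : ℝ}
    (h : HasCollarControlWith I g Φ r₀ r₁ T₁ ε C c) (hε : 0 < ε) {q : ℝ × E3}
    (hq : q ∈ lateShell T₁ r₀ (r₁ + ε)) :
    (∀ v : ℝ × E3, c * ‖v‖ ≤ ‖chartMetric I g Φ q v‖) ∧ ‖chartMetric I g Φ q‖ ≤ C := by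
  obtain ⟨G, -, hGeq, hGb, hGc⟩ := h
  have hq' : q ∈ lateShell T₁ (r₀ - ε) (r₁ + ε) := lateShell_mono le_rfl (by linarith) le_rfl hq
  refine ⟨fun v ↦ ?_, ?_⟩
  · rw [← hGeq q hq]; exact hGc q hq' v
  · have h0 := hGb q hq' 0 (Nat.zero_le _)
    rw [norm_iteratedFDeriv_zero, hGeq q hq] at h0
    exact h0

/-- Unpacking the assembled predicate. [cite: Ellithy2026, Def. 4.4 p. 39] -/
theorem IsQuasiFinalAnalyticCollar.isQuasiFinalAnalytic {Tlo r₀ : ℝ}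
    (h : IsQuasiFinalAnalyticCollar I g Φ Tlo r₀) : IsQuasiFinalAnalytic I g Φ Tlo r₀ := h.1

/-- Unpacking the assembled predicate. [cite: Ellithy2026, Def. 4.4 p. 39] -/
theorem IsQuasiFinalAnalyticCollar.hasUniformCollarControl {Tlo r₀ : ℝ}
    (h : IsQuasiFinalAnalyticCollar I g Φ Tlo r₀) : HasUniformCollarControl I g Φ Tlo r₀ := h.2

end Chart

/-! ### Transport: collar control depends on the chart only through the chart metric on the
late open exterior -/

section Transport

variable {EM : Type*} [NormedAddCommGroup EM] [NormedSpace ℝ EM] {HM : Type*}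
  [TopologicalSpace HM] {I : ModelWithCorners ℝ EM HM} {M : Type*} [TopologicalSpace M]
  [ChartedSpace HM M]
  {EM' : Type*} [NormedAddCommGroup EM'] [NormedSpace ℝ EM'] {HM' : Type*}
  [TopologicalSpace HM'] {I' : ModelWithCorners ℝ EM' HM'} {M' : Type*} [TopologicalSpace M']
  [ChartedSpace HM' M']
  {g : Π x : M, TangentSpace I x →L[ℝ] TangentSpace I x →L[ℝ] ℝ}
  {Φ : ℝ × ℝ × sphere (0 : E3) 1 → M}
  {g' : Π x : M', TangentSpace I' x →L[ℝ] TangentSpace I' x →L[ℝ] ℝ}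
  {Φ' : ℝ × ℝ × sphere (0 : E3) 1 → M'}

/-- **Collar control is a property of the chart metric on the late open exterior part of the
shell**: if the chart metrics `(Φ' ∘ polar)^* g'` and `(Φ ∘ polar)^* g` of two late charts (possibly
on different manifolds) agree on `{t > T₁} × {r₀ < |y| < r₁ + ε}`, control of one on the collar
`[r₀, r₁]` with parameters `(T₁, ε, C, c)` is control of the other with the same parameters (the
same two-sided field `G`).  The definition reads the chart nowhere else. [cite: Ellithy2026, Def. 4.4 p. 39] -/
theorem HasCollarControlWith.congr_chartMetric {r₀ r₁ T₁ ε C c : ℝ}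
    (h : HasCollarControlWith I g Φ r₀ r₁ T₁ ε C c)
    (heq : ∀ q ∈ lateShell T₁ r₀ (r₁ + ε), chartMetric I' g' Φ' q = chartMetric I g Φ q) :
    HasCollarControlWith I' g' Φ' r₀ r₁ T₁ ε C c := by
  obtain ⟨G, hG, hGeq, hGb, hGc⟩ := h
  exact ⟨G, hG, fun q hq ↦ (hGeq q hq).trans (heq q hq).symm, hGb, hGc⟩

/-- **Transport of uniform collar control along equal chart metrics**: if the chart metrics of
two late charts agree on the late open exterior `{t > T̲} × {|y| > r₀}`, uniform `C²` control on
fixed collars of one is uniform `C²` control of the other (collar by collar, same parameters).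
[cite: Ellithy2026, Def. 4.4 p. 39] -/
theorem HasUniformCollarControl.congr_chartMetric {Tlo r₀ : ℝ}
    (h : HasUniformCollarControl I g Φ Tlo r₀)
    (heq : ∀ (t : ℝ) (y : E3), Tlo < t → r₀ < ‖y‖ →
      chartMetric I' g' Φ' (t, y) = chartMetric I g Φ (t, y)) :
    HasUniformCollarControl I' g' Φ' Tlo r₀ := by
  intro r₁ hr₁
  obtain ⟨T₁, ε, C, c, hT₁, hε, hc, hW⟩ := h r₁ hr₁
  exact ⟨T₁, ε, C, c, hT₁, hε, hc,
    hW.congr_chartMetric fun q hq ↦ heq q.1 q.2 (hT₁.trans_lt hq.1) hq.2.1⟩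

/-- **Two late charts with the same ADM coefficient tuple `𝒮` after `T̲` outside `r₀` share uniform
collar control**: `HasADMForm` pins both chart metrics to `𝒮.admForm` on `{t > T̲} × {|y| > r₀}`
(`HasADMForm.chartMetric_eq`), which is all the collar sentence reads of the chart.  Used to move the
collar sentence between a Cartesian model `(ℝ × E3, 𝒮.admForm)` and a manifold chart with the same
tuple. [cite: Ellithy2026, Def. 4.4 p. 39] -/
theorem HasUniformCollarControl.of_hasADMForm {Tlo r₀ : ℝ} {S : ADMTailTuple}
    (h : HasUniformCollarControl I g Φ Tlo r₀) (hg : HasADMForm I g Φ Tlo r₀ S)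
    (hg' : HasADMForm I' g' Φ' Tlo r₀ S) : HasUniformCollarControl I' g' Φ' Tlo r₀ :=
  h.congr_chartMetric fun _ _ ht hy ↦ by
    rw [hg'.chartMetric_eq I' ht hy, hg.chartMetric_eq I ht hy]

/-- The assembled form: `IsQuasiFinalAnalytic` for the second chart together with a shared ADM tuple
and collar control of the first gives `IsQuasiFinalAnalyticCollar` for the second.
[cite: Ellithy2026, Def. 4.4 p. 39] -/
theorem IsQuasiFinalAnalyticCollar.of_hasADMForm {Tlo r₀ : ℝ} {S : ADMTailTuple}
    (h' : IsQuasiFinalAnalytic I' g' Φ' Tlo r₀) (h : HasUniformCollarControl I g Φ Tlo r₀)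
    (hg : HasADMForm I g Φ Tlo r₀ S) (hg' : HasADMForm I' g' Φ' Tlo r₀ S) :
    IsQuasiFinalAnalyticCollar I' g' Φ' Tlo r₀ :=
  ⟨h', h.of_hasADMForm hg hg'⟩

end Transport

end Literature.Geometry.Lorentzian

end
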